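import Mathlib
import HarnessLib
import Summits.CriticalPhenomena.CardyFormulaZ2.Theses.CardyMagicRigidity
import Literature.Probability.Percolation.QuadCrossingRotationInvariance
import Literature.Probability.RandomPlanarGeometry.ConformalRectangle

/-!
# Sketch — crux-ideate stmt-CriticalPhenomena-4837 (LoopsToCrossings), ideator 3

First-lemma signatures for the two idea cards (they need not be proved; they must elaborate):

* card `mono-polarisation-trace-duality`: `dualOpenEdgeUnion`, `dualQuadCrossing`,
  `loopTraceCrossing`, `firstLemma_traceDuality_Z2` (monochromatic non-crossing ⇒ one interface
  loop's trace crosses transversally), `firstLemma_traceTransfer` (trace crossings are d_CN-stable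
  with room), `polarisation_Z2` (the law-level polarisation inequality on bond-ℤ²).
* card `cardy-sandwich-rado-chart`: `firstLemma_rado_crossRatio` (Radó continuity of the
  cross-ratio under uniform convergence of marked boundary loops), `hasCrossingLimit_of_squeeze`.
-/

noncomputable section

open Set Filter Metric MeasureTheory
open scoped Topology
open Literature.Probability.RandomPlanarGeometry Literature.Probability.LatticeModels
open Literature.Probability.Percolation
open UpperHalfPlane (upperHalfPlaneSet)

namespace Summit.CriticalPhenomena.CardyFormulaZ2.Cruxes.LoopsToCrossings.Sketch

/-- The dual-open (= primal-closed) edges of `ω` drawn in `δℤ²`: for each CLOSED nearest-neighbour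
edge `{x,y}` of `ℤ²`, the closed segment of the dual edge, i.e. the segment through the midpoint of
`[δx, δy]` perpendicular to it, of the same length. -/
def dualOpenEdgeUnion (δ : ℝ) (ω : BondConfig (Site 2)) : Set ℂ :=
  ⋃ (x : Site 2) (y : Site 2) (_ : (zdGraph 2).Adj x y) (_ : s(x, y) ∉ ω),
    segment ℝ ((meshPoint δ x + meshPoint δ y) / 2 + Complex.I * (meshPoint δ y - meshPoint δ x) / 2)
      ((meshPoint δ x + meshPoint δ y) / 2 - Complex.I * (meshPoint δ y - meshPoint δ x) / 2)

/-- The Schramm–Smirnov crossing event of the quad `R` at mesh `δ` by a DUAL-open (primal-closed)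
path: the "closed crossing" of the crux's duality, same shape as the tree's `quadCrossing`. -/
def dualQuadCrossing (R : ConformalRectangle) (δ : ℝ) : Set (BondConfig (Site 2)) :=
  {ω | ∃ a ∈ R.arc 0, ∃ b ∈ R.arc 2, JoinedIn (closure R.carrier ∩ dualOpenEdgeUnion δ ω) a b}

/-- The MONOCHROMATIC crossing event: `R` is crossed from `arc 0` to `arc 2` by an open primal path
OR by a dual-open path. -/
def monoQuadCrossing (R : ConformalRectangle) (δ : ℝ) : Set (BondConfig (Site 2)) :=
  quadCrossing R δ ∪ dualQuadCrossing R δ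

/-- TRANSVERSAL TRACE CROSSING (a pure loop functional): some loop of the typed configuration `c`
has a trace containing a continuum inside the `r`-thickened closed quad joining the `r`-thickened
lateral sides `arc 1` and `arc 3` (`r = 0`: an honest Schramm–Smirnov crossing of the transposed
quad by the trace). The thickening parameter is the "room" of the card. -/
def loopTraceCrossing (R : ConformalRectangle) (r : ℝ) (c : LoopConfig ℂ) : Prop :=
  ∃ i : Fin 2, ∃ u ∈ c.F i, ∃ K : Set ℂ, IsCompact K ∧ IsConnected K ∧ K ⊆ u.range ∧
    K ⊆ Metric.cthickening r (closure R.carrier) ∧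
    (K ∩ Metric.cthickening r (R.arc 1)).Nonempty ∧ (K ∩ Metric.cthickening r (R.arc 3)).Nonempty

/-- FIRST LEMMA (card `mono-polarisation-trace-duality`), TRACE DUALITY on bond-ℤ²: if the quad is
crossed from `arc 0` to `arc 2` NEITHER by an open primal path NOR by a dual-open path, then ONE
full-plane interface loop of `ω` (a member of DKKMO's typed configuration `bondLoopConfig δ 0 ω`)
has a trace crossing the quad transversally, up to room `δ` (the medial polyline runs at distance
`≤ δ/√2` from the primal/dual structures it separates). Proof idea: H := primal and dual clusters
touching `arc 0`, R := the rest reachable from `arc 2`; the medial edges between H-faces and R-faces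
separate and are a union of arcs of the loop decomposition (at each edge midpoint the H/R-boundary
uses exactly the pairs of medial edges paired by `ω`), so a separating medial path from `arc 1` to
`arc 3` is an arc of a single loop. -/
def firstLemma_traceDuality_Z2 : Prop :=
  ∀ (R : ConformalRectangle) (δ : ℝ), 0 < δ → ∀ ω : BondConfig (Site 2),
    ω ∉ monoQuadCrossing R δ → loopTraceCrossing R δ (bondLoopConfig δ 0 ω)

/-- Converse half with room (deterministic): a transversal trace crossing with NEGATIVE room (the
continuum stays `r`-inside the quad and overshoots both lateral sides, phrased through a harder
quad `R'` whose closed carrier thickened by `r` lies in `R`'s and whose thickened lateral arcs lie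
outside `closure R.carrier`) kills every monochromatic crossing of `R` from `arc 0` to `arc 2`
(open primal and dual-open paths never cross an interface trace transversally). -/
def converse_traceDuality_Z2 : Prop :=
  ∀ (R R' : ConformalRectangle) (δ r : ℝ), 0 < δ → δ < r →
    Metric.cthickening r (closure R'.carrier) ⊆ closure R.carrier ∪ Metric.cthickening r (R'.arc 1) ∪
      Metric.cthickening r (R'.arc 3) →
    Disjoint (Metric.cthickening r (R'.arc 1) ∪ Metric.cthickening r (R'.arc 3)) (closure R.carrier) →
    (∀ K : Set ℂ, IsConnected K → K ⊆ Metric.cthickening r (closure R'.carrier) →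
      (K ∩ Metric.cthickening r (R'.arc 1)).Nonempty → (K ∩ Metric.cthickening r (R'.arc 3)).Nonempty →
      ∀ L : Set ℂ, IsConnected L → L ⊆ closure R.carrier → (L ∩ R.arc 0).Nonempty →
        (L ∩ R.arc 2).Nonempty → (K ∩ L).Nonempty) →
    ∀ ω : BondConfig (Site 2), loopTraceCrossing R' r (bondLoopConfig δ 0 ω) → ω ∉ monoQuadCrossing R δ

/-- FIRST LEMMA bis (deterministic TRANSFER of trace crossings under DKKMO closeness): if two typed
configurations are `η`-close in DKKMO's printed sense (`LoopConfig.IsClose`), the quad with room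
`r` sits inside the window `B(0, 1/η - …)`, and `c` has a transversal trace crossing with room `r`
realised by a loop lying in the window, then `c'` has one with room `r + η` (a loop `η`-close in
the unbased uniform distance has a trace within Hausdorff distance `η`, and a uniformly `η`-close
reparametrised curve of a crossing continuum is a crossing of the `η`-fattened quad). No
probability, no arm event. -/
def firstLemma_traceTransfer : Prop :=
  ∀ (R : ConformalRectangle) (η r : ℝ), 0 < η → 0 ≤ r →
    ∀ c c' : LoopConfig ℂ, LoopConfig.IsClose η c c' →
      (∃ i : Fin 2, ∃ u ∈ c.F i, u.range ⊆ Metric.ball (0 : ℂ) (1 / η) ∧ ∃ K : Set ℂ,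
        IsCompact K ∧ IsConnected K ∧ K ⊆ u.range ∧ K ⊆ Metric.cthickening r (closure R.carrier) ∧
        (K ∩ Metric.cthickening r (R.arc 1)).Nonempty ∧ (K ∩ Metric.cthickening r (R.arc 3)).Nonempty) →
      loopTraceCrossing R (r + η) c'

/-- The tri-side typed loop configuration of the crux (verbatim the lambda of `LoopsToCrossings`). -/
def triLoopConfig (δ : ℝ) (cfg : Literature.Probability.Percolation.SiteConfig (Site 2)) : LoopConfig ℂ :=
  ⟨fun i ↦ {u : UnbasedLoop ℂ | ∃ (v : HexVertex) (γ : hexGraph.Walk v v),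
    IsSiteInterfaceLoop cfg γ ∧ (i = 1 ↔ 0 < shoelace (γ.support.map hexCenter)) ∧
    u = UnbasedLoop.mk (BasedLoop.mk (siteLoopCurve δ γ) (isLoop_siteLoopCurve δ γ))}⟩

/-- POLARISATION INEQUALITY (law level, bond-ℤ², one direction; the only probabilistic content is
colour/shift symmetry of `P_{1/2}` and inclusion–exclusion): for quads `R ≥ R'` in the
Schramm–Smirnov order with room `> δ` (every open crossing of `R` contains one of `R'` AND one of
the half-diagonal shift of `R'`),
`2·P[open crossing of R] ≤ 1 + P[mono crossing of R'] − P[mono transversal crossing of R']`.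
Here the transversal mono event is read on the conformal rectangle with marks rotated by one. -/
def polarisation_Z2 : Prop :=
  ∀ (R R' Rt : ConformalRectangle) (δ : ℝ), 0 < δ →
    -- `Rt` is `R'` with the marked points rotated by one (transversal reading)
    Rt.carrier = R'.carrier → Rt.arc 0 = R'.arc 1 → Rt.arc 2 = R'.arc 3 →
    -- room: open crossings of `R` contain open crossings of `R'` and of its half-diagonal shift
    quadCrossing R δ ⊆ quadCrossing R' δ →
    (∀ ω, ω ∈ quadCrossing R δ → ∃ a ∈ R'.arc 0, ∃ b ∈ R'.arc 2,
      JoinedIn (closure R'.carrier ∩ ((fun z ↦ z - (δ : ℂ) * (1 + Complex.I) / 2) '' openEdgeUnion δ ω)) a b) →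
    2 * quadCrossingProb δ R ≤ 1 + (bondPercolation (zdGraph 2) half).real (monoQuadCrossing R' δ) -
      (bondPercolation (zdGraph 2) half).real (monoQuadCrossing Rt δ)

/-- FIRST LEMMA (card `cardy-sandwich-rado-chart`), RADÓ CONTINUITY OF THE CROSS-RATIO: if the
marked boundary loops of conformal rectangles `Q n` converge uniformly to that of `R` (with the
same period-1 parametrisation) and the marked parameters converge, then for every uniformizing
datum `(φ, x)` of `R` there are uniformizing data of the `Q n` whose cross-ratios converge to
`crossRatio x` (T. Radó 1923: Fréchet convergence of Jordan curves ⇒ uniform convergence of the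
normalised Riemann maps on the closed disc). -/
def firstLemma_rado_crossRatio : Prop :=
  ∀ (R : ConformalRectangle) (Q : ℕ → ConformalRectangle),
    TendstoUniformly (fun n ↦ (Q n).boundary) R.boundary atTop →
    (∀ i, Tendsto (fun n ↦ (Q n).mark i) atTop (𝓝 (R.mark i))) →
    ∀ (φ : ConformalEquiv upperHalfPlaneSet R.carrier) (x : Fin 4 → ℝ), R.IsUniformizing φ x →
      ∃ (ψ : ∀ n, ConformalEquiv upperHalfPlaneSet (Q n).carrier) (y : ℕ → Fin 4 → ℝ),
        (∀ n, (Q n).IsUniformizing (ψ n) (y n)) ∧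
        Tendsto (fun n ↦ crossRatio (y n)) atTop (𝓝 (crossRatio x))

/-- SQUEEZE (pure analysis + Smirnov-on-𝕋, the assembly shape of card `cardy-sandwich-rado-chart`):
if for every `ε > 0` the bond crossing probability of `R` is eventually squeezed, up to `ε`, between
the tri crossing probabilities of two conformal rectangles whose Cardy values are `ε`-close to
`F(crossRatio x)`, then `R.HasCrossingLimit bond F` (with Smirnov on 𝕋, `SmirnovTri`, supplying the
tri limits). Provable now (real analysis); recorded to fix the interface. -/
theorem hasCrossingLimit_of_squeeze (R : ConformalRectangle) (p : ℝ → ℝ)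
    (hS : ∀ Q : ConformalRectangle, Q.HasCrossingLimit (triDomainCrossingProb Q) cardyFunction)
    (hcont : Continuous cardyFunction)
    (h : ∀ (φ : ConformalEquiv upperHalfPlaneSet R.carrier) (x : Fin 4 → ℝ), R.IsUniformizing φ x →
      ∀ ε > 0, ∃ (Qp Qm : ConformalRectangle) (φp : ConformalEquiv upperHalfPlaneSet Qp.carrier)
        (xp : Fin 4 → ℝ) (φm : ConformalEquiv upperHalfPlaneSet Qm.carrier) (xm : Fin 4 → ℝ),
        Qp.IsUniformizing φp xp ∧ Qm.IsUniformizing φm xm ∧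
        |cardyFunction (crossRatio xp) - cardyFunction (crossRatio x)| ≤ ε ∧
        |cardyFunction (crossRatio xm) - cardyFunction (crossRatio x)| ≤ ε ∧
        ∀ᶠ δ in 𝓝[>] (0 : ℝ), p δ ≤ triDomainCrossingProb Qp δ + ε ∧ triDomainCrossingProb Qm δ - ε ≤ p δ) :
    R.HasCrossingLimit p cardyFunction := by
  intro φ x hφx
  rw [Metric.tendsto_nhds]
  intro ε hε
  obtain ⟨Qp, Qm, φp, xp, φm, xm, hup, hum, hFp, hFm, hev⟩ := h φ x hφx (ε / 3) (by positivity)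
  have htp := (Metric.tendsto_nhds.1 (hS Qp φp xp hup)) (ε / 3) (by positivity)
  have htm := (Metric.tendsto_nhds.1 (hS Qm φm xm hum)) (ε / 3) (by positivity)
  filter_upwards [hev, htp, htm] with δ hδ hp hm
  rw [Real.dist_eq] at hp hm ⊢
  rw [abs_sub_lt_iff] at hp hm ⊢
  rw [abs_sub_le_iff] at hFp hFm
  constructor <;> linarith [hδ.1, hδ.2]

end Summit.CriticalPhenomena.CardyFormulaZ2.Cruxes.LoopsToCrossings.Sketch

end
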